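/-
Copyright: lit-balaban reader/typer seat r18 (gen 9), C2 §§1–4 fold owner.  Statement-level skeleton of a published paper; no proof
claims beyond what the kernel checks below.
-/
import Literature.MathematicalPhysics.QuantumFieldTheory.BalabanImbrieJaffe1984to88.BIJ88Normalization46

/-!
# `BalabanImbrieJaffe1984to88.BIJ88Eq411Scaling` — T. Bałaban, J. Imbrie, A. Jaffe, *Effective action and cluster properties of the
abelian Higgs model*, Commun. Math. Phys. **114** (1988) 257–315 [BalabanImbrieJaffe1988], p. 275 [PDF 19]: *"Similarly for the scalar
field we have Z^{(j)}_{Λ₁₀^{(j)}}(u_k) = ∫𝒟φ_{Λ₁₀^{(j)}} exp(−½⟨Λ₁₀^{(j)}φ, (Δ^{L^jη}_{j,loc}(u_k) + aL^{−2}P(u_k))Λ₁₀^{(j)}φ⟩ − E^{(j)}_{k,s}|Λ₁₀^{(j)}|),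
(4.9) with P(u_k) = Q(u_k)*Q(u_k), (4.10) E^{(j)}_{k,s} = −(d−2) log L^jη. (4.11)"* — the word *"Similarly"* refers to the preceding
sentence *"We have included a constant factor to take care of the scalings and make this independent of k"*: **THE SCALING LAW OF THE
SCALAR NORMALIZATION FACTOR (4.9) AND ITS COMPENSATION BY (4.11)**, kernel-checked in the finite-dimensional model of record
(`BIJ88Normalization46.Z49`: a Gaussian integral over `|ι| = 2|Λ₁₀|` real coordinates).  Companion of `BIJ88Eq47Scaling` (the gauge-field
factor (4.6)/(4.7)).

statement-level skeleton of published theorems with citation tags; proofs where landed; nothing here is a claim about the Yang–Mills mass gap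

PDF held: `paper:balaban1988-cmp114-bij-abelian-higgs-effective-action` (journal page = PDF page + 256); p. 275 [PDF 19] text layer re-read
this session (`~/.lit/texts/paper-balaban1988-cmp114-bij-abelian-higgs-effective-action/p0019.txt`; the displays (4.9)–(4.11) are legible
there up to OCR noise and agree with r18 gen 2's quotation in `BIJ88Normalization46`/`BIJ88Sect4Statements`).

CITATION HEADER (lean-in-tree rule).  Part of the lit-balaban TYPED SKELETON (HOME `run/shared/lean/pub/lit-balaban/`): rows **C2.Eq4.9** /
**C2.Eq4.11** of `HOME/lit-balaban-r18/ROWS-C2.md` (fold owner r18; DEF rows — `BIJ88Normalization46.Z49` with closed form `Z49_eq` PROVED,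
first-step torus instance `BIJ88Normalization49Torus`; `BIJ88Sect4Statements.Eks`).  Unit `lit-balaban-r18` (literature-prover-lit-balaban-r18-g9-0),
gen 9.

THE READING.  At step `k` the level-`j` scalar factor is a Gaussian integral over the complex field `φ` on the sites of `Λ₁₀^{(j)}` of the
`L^jη`-lattice (`ξ = L^jη = L^{j−k}`), i.e. over `|ι| = 2|Λ₁₀^{(j)}|` real coordinates with Lebesgue measure `𝒟φ` (no charge factor, unlike
the gauge field), times `exp(−E^{(j)}_{k,s}|Λ₁₀^{(j)}|) = ξ^{(d−2)|Λ₁₀|}`.  By (2.12) the quadratic form is the step-`j` form rescaled to spacing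
`ξ`; for the precision of a field of scaling dimension `(length)^{−(d−2)/2}` this multiplies the precision matrix by `ξ^{d−2}` (the inverse
of the covariance exponent `2 − d` of the cell's dictionary, `BIJ88Decay216Native.cE_ambient_eq_native`).  The model of record evaluates
(4.9) as `Z = e^{−E|Λ₁₀|}(2π)^{|ι|/2}(det T)^{−1/2}` (`BIJ88Normalization46.Z49_eq`).  WHAT IS PROVED (theorems only; 0 `sorry`; standard axioms):
**`Z49_of_smul`** (`Z[a•T] = a^{−|ι|/2}·Z[T]` for `T` positive definite, `a > 0`: THE SCALING LAW — one factor `a^{−1/2}` per real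
integration), `log_Z49_of_smul`, and **`Z49_Eks_of_smul`** / `log_Z49_Eks_of_smul` (THE COMPENSATION: with `a = ξ^{d−2}`, `|ι| = 2|Λ₁₀|`
and the constant (4.11) at `L^jη = ξ`, `Z49 (ξ^{d−2}•T) (Eks d ξ) |Λ₁₀| = Z49 T (Eks d 1) |Λ₁₀|` — *"independent of k"*).
HONEST SCOPE.  (i) As for (4.6): the step-`k` form of the level-`j` factor («precision × `ξ^{d−2}` on the same index set») is the (2.12)
rescaling convention, DISPLAYED as the hypothesis (the theorem is stated for `a•T` versus `T`); it is not derived here from a rescaling map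
on densities, and how the two summands `Δ_{j,loc}(u_k)` and `aL^{−2}P(u_k)` individually move with `k` (the running `a_k` of (2.34)) is NOT
addressed — only the total precision's homogeneity is used.  (ii) No torus instance is asserted beyond r18 gen 7's first-step `T49`
(any positive definite `T` is covered).  (iii) No row head changes ((4.9)/(4.11) are DEF rows; the sentence is recorded in their cells).
No `def`, no new named fact, nothing restated.
-/

namespace Literature.MathematicalPhysics.QuantumFieldTheory.BalabanImbrieJaffe1984to88.BIJ88Eq411Scaling

open Matrix
open Literature.MathematicalPhysics.QuantumFieldTheory.Balaban1983to89
open BIJ88Normalization46 (Z49 Z49_eq Z49_pos log_Z49 log_Z49_sites)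
open BIJ88Sect4Statements (Eks)

noncomputable section

variable {ι : Type*} [Fintype ι] [DecidableEq ι] {T : Matrix ι ι ℝ} {a : ℝ}

/-- **THE SCALING LAW OF (4.9), logarithmic form**: `log Z[a•T] = log Z[T] − (|ι|/2)·log a` for `T` positive definite and `a > 0` —
`det(a•T) = a^{|ι|}·det T`. [cite: BalabanImbrieJaffe1988, (4.9) p.275] -/
theorem log_Z49_of_smul (hT : T.PosDef) (ha : 0 < a) (E N : ℝ) :
    Real.log (Z49 (a • T) E N) = Real.log (Z49 T E N) - (Fintype.card ι : ℝ) / 2 * Real.log a := by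
  have haT : (a • T).PosDef := hT.smul ha
  rw [log_Z49 _ haT E N, log_Z49 _ hT E N, Matrix.det_smul, Real.log_mul (pow_ne_zero _ ha.ne') hT.det_pos.ne', Real.log_pow]
  ring

/-- **THE SCALING LAW OF (4.9)**: rescaling the precision by `a > 0` multiplies the scalar normalization factor by `a^{−|ι|/2}` — one factor
`a^{−1/2}` per real integration (`|ι| = 2|Λ₁₀^{(j)}|` real coordinates of the complex field). [cite: BalabanImbrieJaffe1988, (4.9) p.275] -/
theorem Z49_of_smul (hT : T.PosDef) (ha : 0 < a) (E N : ℝ) :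
    Z49 (a • T) E N = (a ^ ((Fintype.card ι : ℝ) / 2))⁻¹ * Z49 T E N := by
  have haT : (a • T).PosDef := hT.smul ha
  have h1 : Real.log (Z49 (a • T) E N) = Real.log ((a ^ ((Fintype.card ι : ℝ) / 2))⁻¹ * Z49 T E N) := by
    rw [log_Z49_of_smul hT ha, Real.log_mul (inv_pos.2 (Real.rpow_pos_of_pos ha _)).ne' (Z49_pos T hT E N).ne', Real.log_inv,
      Real.log_rpow ha]
    ring
  exact Real.log_injOn_pos (Set.mem_Ioi.2 (Z49_pos _ haT E N))
    (Set.mem_Ioi.2 (mul_pos (inv_pos.2 (Real.rpow_pos_of_pos ha _)) (Z49_pos T hT E N))) h1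

variable {ξ : ℝ} {d nΛ : ℕ}

/-- **THE p.275 SENTENCE FOR THE SCALAR FACTOR, logarithmic form** (*"Similarly for the scalar field …"* with (4.11)): if the step-`k` precision
of the level-`j` scalar factor is `ξ^{d−2}` times the step-`j` one on the same `|ι| = 2|Λ₁₀|` real coordinates (`ξ = L^jη > 0`, `d ≥ 2`),
then with `E^{(j)}_{k,s} = −(d−2) log ξ` the logarithm of (4.9) takes its step-`j` value (`ξ = 1`). [cite: BalabanImbrieJaffe1988, (4.11) p.275] -/
theorem log_Z49_Eks_of_smul (hT : T.PosDef) (hξ : 0 < ξ) (hd : 2 ≤ d) (hι : Fintype.card ι = 2 * nΛ) :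
    Real.log (Z49 ((ξ ^ (d - 2)) • T) (Eks d ξ) nΛ) = Real.log (Z49 T (Eks d 1) nΛ) := by
  have ha : 0 < ξ ^ (d - 2) := pow_pos hξ _
  have hcast : ((d - 2 : ℕ) : ℝ) = (d : ℝ) - 2 := by rw [Nat.cast_sub hd, Nat.cast_two]
  rw [log_Z49_sites _ (hT.smul ha) d nΛ ξ hι, log_Z49_sites _ hT d nΛ 1 hι, Matrix.det_smul,
    Real.log_mul (pow_ne_zero _ ha.ne') hT.det_pos.ne', Real.log_pow, Real.log_pow, hι, hcast, Real.log_one]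
  push_cast
  ring

/-- **THE p.275 SENTENCE FOR THE SCALAR FACTOR**: under the same hypotheses `Z49 (ξ^{d−2}•T) (E^{(j)}_{k,s}) |Λ₁₀| = Z49 T (E^{(j)}_{j,s}) |Λ₁₀|`
— the level-`j` scalar normalization factor (4.9), with its constant (4.11), does not depend on the step `k` at which it is read.
[cite: BalabanImbrieJaffe1988, (4.11) p.275] -/
theorem Z49_Eks_of_smul (hT : T.PosDef) (hξ : 0 < ξ) (hd : 2 ≤ d) (hι : Fintype.card ι = 2 * nΛ) :
    Z49 ((ξ ^ (d - 2)) • T) (Eks d ξ) nΛ = Z49 T (Eks d 1) nΛ :=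
  Real.log_injOn_pos (Set.mem_Ioi.2 (Z49_pos _ (hT.smul (pow_pos hξ _)) _ _)) (Set.mem_Ioi.2 (Z49_pos _ hT _ _))
    (log_Z49_Eks_of_smul hT hξ hd hι)

end

end Literature.MathematicalPhysics.QuantumFieldTheory.BalabanImbrieJaffe1984to88.BIJ88Eq411Scaling
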